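import Summits.QuantumFields.BalabanUV.T4Continuum.Support.NE3SmoothLiftCurl
import Summits.QuantumFields.BalabanUV.T4Continuum.Support.NE3CoercivityScaling
import Literature.MathematicalPhysics.QuantumFieldTheory.Balaban1983to89.Beta.PoissonInterior
import HarnessLib

/-!
# NE7FlatGradientLetterCompact — THE FLAT C¹ COMPACT LETTER (dipole form): a flat (`U = 1`) matrix-valued bond field `Z` supported in a cube of
# radius `R` satisfies `‖Z(x + e_μ, κ) − Z(x, κ)‖ ≤ C(d)·(R + 1)·(B′ + D′)` with `B′ ≥ sup‖∇(curlAt 1 Z)‖`, `D′ ≥ sup‖∇(flatDiv Z)‖` — ONE LATTICE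
# DERIVATIVE ON THE DATA, the dipole row sum `Σ_{y ∈ cube}|∇G₀(x − y)| = O(R)` of the Newton potential; INTERFACE REQUEST NE7 stub (S-c) answered

Cell `pub-balaban`, rung (B)+1 sub-cell t4; written by the row-NE7b OWNER lineage `b2b-balaban-t4-ne7b-p1` (gen 154) for the sibling crux row NE7
(lineage `t4-ne7-p1`, gen 106's INTERFACE REQUEST NE7 stub (S-c), `HOME/INBOX.md` [NE7P1-G106-INBOX-2] 2026-08-30T21:40Z, memo
`t4/b2b-balaban-t4-ne7-p1-g106/ROAD-G106.md` §4: «THE FLAT C¹ COMPACT LETTER (dipole form) in the `Site (d+1)` ∕ periodic vocabulary of gen 101's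
`NE7FlatSupLetterCompact` — (i) `‖Z(x + e_μ, κ) − Z(x, κ)‖ ≤ C·(M N′)·(sup‖∇(curlAt 1 Z)‖ + sup‖∇(flatDiv Z)‖)` — one lattice derivative ON THE DATA, the
DIPOLE row sum `Σ_y |∇_x G(x,y)| = O(radius)` of the flat Laplacian»).  This file is (i); the modulus companion (ii) is its sequel.

THE MECHANISM ([folklore] discrete potential theory; every analytic input is a TREE theorem BY NAME).
 (1) `lapVec_eq_curl_div` — on the flat lattice the componentwise second-difference Laplacian of a bond field is one difference of its flat curl plus one
     difference of its flat divergence: `Σ_μ [(Z(x+e_μ,κ) − Z(x,κ)) − (Z(x,κ) − Z(x−e_μ,κ))] = Σ_μ [curlAt 1 Z (x;μ,κ) − curlAt 1 Z (x−e_μ;μ,κ)] +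
     [flatDiv Z (x+e_κ) − flatDiv Z x]` (`−Δ = δd + dδ` on 1-forms, read through `NE3SmoothLiftCurl.curlAt_flat_eq` and `NE3CoercivityScaling.flatDiv`);
     hence `norm_lapVec_le`: `‖Δ Z_κ‖ ≤ d·B′ + D′`.
 (2) the β-team's `Beta/PoissonInterior` (pv23, KERNEL): the Newton potential `G₀` (`ΔG₀ = −δ₀`), its dipole envelope `G₀_diff_bound`
     (`|∇G₀(v)| ≤ C₁·nrm(v)^{1−d}`), the Green representation of a finitely supported function `green_rep` (`w(x) = −Σ_{cube} G₀(x−y)Δw(y)`), and the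
     shell count `sum_cube_inv_nrm_pow_le` (`Σ_{‖z‖_∞ ≤ R′} nrm(z)^{1−d} ≤ 1 + 2d·3^{d−1}·R′` — the dipole row sum is ONE POWER OF THE RADIUS).
 (3) matrix values: for every real-linear functional `f` of norm ≤ 1 the scalar field `f ∘ Z_κ` is finitely supported with `Δ(f ∘ Z_κ) = f(ΔZ_κ)`
     (`lap_dual_apply`), so (2) bounds `|f(Z(x+e_μ,κ) − Z(x,κ))|`; `NormedSpace.norm_le_dual_bound` returns to the (L²-operator) matrix norm with NO
     dimension factor.
WHAT ([folklore]; 0 def, 0 sorry; every `d ≥ 3`; constants existential in `d` because lit1's Green-function constants are).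
§1 `lapVec_eq_curl_div`, `curlAt_flat_diag` (`curlAt 1 Z z μ μ = 0`), `norm_lapVec_le`, `lap_dual_apply`.  §2 `mem_cube_succ_of_add_e`, `sum_cube_inv_nrm_sub_le`
(the dipole row sum over `cube c (R+1)` seen from any of its points: `≤ 1 + 2d·3^{d−1}·(2R+2)`).  §3 **`gradient_letter_cube`** — `∃ C ≥ 0` (a function of `d`):
for every cube `cube c R` (sup-norm radius `R`, `PoissonInterior.cube`), every bond field `Z : Site d → Fin d → Matrix n n ℂ` vanishing off it, every `B′ ≥ 0` with
`‖curlAt 1 Z (z + e_λ) μ ν − curlAt 1 Z z μ ν‖ ≤ B′` (`μ ≠ ν`), every `D′` with `‖flatDiv Z (x + e_λ) − flatDiv Z x‖ ≤ D′`: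
`‖Z (x + e_μ) κ − Z x κ‖ ≤ C·(R + 1)·(B′ + D′)` for all `x, μ, κ`.  §4 **`gradient_letter_box`** — the same in gen 101's block-aligned-box geometry
(dimension `d + 1 ≥ 3`, `M = L^{k+1}`, box `M•c′ + [0, M·N′)^{d+1}`, `Z` vanishing off the box — in particular off its `4M`-interior as in
`NE7FlatSupLetterCompact.sup_flat_compact`): `‖Z (x + e_μ) κ − Z x κ‖ ≤ K·(L^{k+1}·N′)·(B′ + D′)`, `K` a function of `d` only.
HONEST FRAMING (page 1): `U = 1`, linear, flat; a JUNCTION over pv23's potential theory — nothing new is estimated beyond bookkeeping; NOT the curved C¹ letter,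
NOT the supplier of (Lip₁ᶜ)(Höl½ᶜ), NOT NE7, nothing of row NE7b (`T4WeightBudget.RelWeightBound` NOT PRINTED ∕ NOT PROVED); nothing of Bałaban's asserted;
spine count = dagwriter∕referees' call; finite T⁴ rung (B)+1 — NOT infinite volume, NOT mass gap, NOT BetaPertH, NOT Clay.  Continuum YM on T⁴ ⇐ BetaPertH ∧
nine spine estimates (0/9 proved); BetaPertH ⇐ (D1) ∧ (D4) ∧ CAP+tail; G-an2-4 gates asym, D1 and NE2/3/4.
-/

set_option autoImplicit false

open scoped BigOperators Matrix.Norms.L2Operator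
open Finset

namespace Summit.QuantumFields.BalabanUV.T4Continuum.NE7FlatGradientLetterCompact

open Literature.MathematicalPhysics.QuantumFieldTheory.Balaban1983to89
open B7Prop1Explicit (Site e)
open T4AveragingDeficitWall (curlAt)
open BlockAveragePushDirSplit (flat)
open NE3CoercivityScaling (flatDiv)
open NE3SmoothLiftCurl (curlAt_flat_eq)
open Literature.Probability.LatticeModels (latticeLaplacianZd latticeLaplacianZd_def)
open Beta.PoissonInterior (cube mem_cube cube_mono nrm nrm_pos G₀ G₀_diff_bound green_rep sum_cube_inv_nrm_pow_le)

noncomputable section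

variable {d : ℕ} {n : Type*} [Fintype n] [DecidableEq n]

/-! ## §1 The componentwise lattice Laplacian of a bond field through its flat curl and flat divergence -/

/-- **`−ΔZ_κ = (δdZ + dδZ)_κ` ON THE FLAT LATTICE**, written with the tree's `curlAt 1` and `flatDiv`:
`Σ_μ [(Z(x+e_μ,κ) − Z(x,κ)) − (Z(x,κ) − Z(x−e_μ,κ))] = Σ_μ [curlAt 1 Z (x;μ,κ) − curlAt 1 Z (x−e_μ;μ,κ)] + [flatDiv Z (x+e_κ) − flatDiv Z x]`. [folklore] -/
theorem lapVec_eq_curl_div (Z : Site d → Fin d → Matrix n n ℂ) (x : Site d) (κ : Fin d) :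
    ∑ μ, ((Z (x + e μ) κ - Z x κ) - (Z x κ - Z (x - e μ) κ)) =
      ∑ μ, (curlAt (flat (d := d) (n := n)) Z x μ κ - curlAt (flat (d := d) (n := n)) Z (x - e μ) μ κ)
        + (flatDiv Z (x + e κ) - flatDiv Z x) := by
  have hdiv : flatDiv Z (x + e κ) - flatDiv Z x =
      ∑ μ, ((Z (x + e κ) μ - Z (x + e κ - e μ) μ) - (Z x μ - Z (x - e μ) μ)) := by
    simp only [flatDiv, Finset.sum_sub_distrib]
  rw [hdiv, ← Finset.sum_add_distrib]
  refine Finset.sum_congr rfl fun μ _ => ?_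
  have h1 : x - e μ + e μ = x := sub_add_cancel x (e μ)
  have h2 : x - e μ + e κ = x + e κ - e μ := by abel
  rw [curlAt_flat_eq, curlAt_flat_eq, h1, h2]
  abel

/-- The flat curl vanishes on the diagonal: `curlAt 1 Z z μ μ = 0`. [folklore] -/
theorem curlAt_flat_diag (Z : Site d → Fin d → Matrix n n ℂ) (z : Site d) (μ : Fin d) :
    curlAt (flat (d := d) (n := n)) Z z μ μ = 0 := by
  rw [curlAt_flat_eq, sub_self]

/-- **`‖ΔZ_κ(x)‖ ≤ d·B′ + D′`** from `B′ ≥ sup‖∇(curlAt 1 Z)‖` (off-diagonal planes) and `D′ ≥ sup‖∇(flatDiv Z)‖`. [folklore] -/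
theorem norm_lapVec_le (Z : Site d → Fin d → Matrix n n ℂ) {B' D' : ℝ} (hB0 : 0 ≤ B')
    (hB : ∀ (z : Site d) (lam μ ν : Fin d), μ ≠ ν →
      ‖curlAt (flat (d := d) (n := n)) Z (z + e lam) μ ν - curlAt (flat (d := d) (n := n)) Z z μ ν‖ ≤ B')
    (hD : ∀ (x : Site d) (lam : Fin d), ‖flatDiv Z (x + e lam) - flatDiv Z x‖ ≤ D')
    (x : Site d) (κ : Fin d) :
    ‖∑ μ, ((Z (x + e μ) κ - Z x κ) - (Z x κ - Z (x - e μ) κ))‖ ≤ d * B' + D' := by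
  rw [lapVec_eq_curl_div]
  refine (norm_add_le _ _).trans (add_le_add ?_ (hD x κ))
  calc ‖∑ μ, (curlAt (flat (d := d) (n := n)) Z x μ κ - curlAt (flat (d := d) (n := n)) Z (x - e μ) μ κ)‖
      ≤ ∑ _μ : Fin d, B' := (norm_sum_le _ _).trans (Finset.sum_le_sum fun μ _ => ?_)
    _ = d * B' := by simp
  by_cases hμ : μ = κ
  · subst hμ
    rw [curlAt_flat_diag, curlAt_flat_diag, sub_zero, norm_zero]
    exact hB0
  · have h := hB (x - e μ) μ μ κ hμ
    rwa [sub_add_cancel] at h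

omit [Fintype n] [DecidableEq n] in
/-- The scalar Laplacian of a real-linear functional of a component is the functional of the componentwise Laplacian:
`Δ(f ∘ Z_κ)(y) = f(Σ_μ [(Z(y+e_μ,κ) − Z(y,κ)) − (Z(y,κ) − Z(y−e_μ,κ))])`. [folklore] -/
theorem lap_dual_apply (f : Matrix n n ℂ →L[ℝ] ℝ) (Z : Site d → Fin d → Matrix n n ℂ) (κ : Fin d) (y : Site d) :
    latticeLaplacianZd (fun z => f (Z z κ)) y = f (∑ μ, ((Z (y + e μ) κ - Z y κ) - (Z y κ - Z (y - e μ) κ))) := by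
  rw [map_sum, latticeLaplacianZd_def]
  have he : ∀ i : Fin d, (e i : Site d) = Pi.single i 1 := fun i => rfl
  have hsum : ∀ i : Fin d, f ((Z (y + e i) κ - Z y κ) - (Z y κ - Z (y - e i) κ))
      = (f (Z (y + Pi.single i 1) κ) + f (Z (y - Pi.single i 1) κ)) - 2 * f (Z y κ) := by
    intro i
    rw [map_sub, map_sub, map_sub, he]
    ring
  simp_rw [hsum]
  rw [Finset.sum_sub_distrib, Finset.sum_const, Finset.card_univ, Fintype.card_fin, nsmul_eq_mul]
  ring

/-! ## §2 The dipole row sum over a cube, seen from a point of the cube -/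

omit [Fintype n] [DecidableEq n] in
/-- `x + e_μ ∈ cube c R ⟹ x ∈ cube c (R+1)`. [folklore] -/
theorem mem_cube_succ_of_add_e {c x : Site d} {R : ℕ} {μ : Fin d} (h : x + e μ ∈ cube c R) : x ∈ cube c (R + 1) := by
  rw [mem_cube] at h ⊢
  intro i
  have hi := h i
  have hs : |(e μ : Site d) i| ≤ 1 := by
    change |(Pi.single μ (1 : ℤ) : Site d) i| ≤ 1
    rw [Pi.single_apply]
    split_ifs <;> simp
  have : x i - c i = ((x + e μ) i - c i) - (e μ : Site d) i := by simp only [Pi.add_apply]; ring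
  rw [this]
  calc |((x + e μ) i - c i) - (e μ : Site d) i| ≤ |(x + e μ) i - c i| + |(e μ : Site d) i| := abs_sub _ _
    _ ≤ (R : ℤ) + 1 := add_le_add hi hs
    _ = ((R + 1 : ℕ) : ℤ) := by push_cast; ring

omit [Fintype n] [DecidableEq n] in
/-- **THE DIPOLE ROW SUM IS ONE POWER OF THE RADIUS**: for `x ∈ cube c (R+1)`, `Σ_{y ∈ cube c (R+1)} nrm(x − y)^{1−d} ≤ 1 + 2d·3^{d−1}·(2R+2)`. [folklore] -/
theorem sum_cube_inv_nrm_sub_le (hd : 3 ≤ d) (c x : Site d) (R : ℕ) (hx : x ∈ cube c (R + 1)) :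
    ∑ y ∈ cube c (R + 1), 1 / nrm (x - y) ^ (d - 1) ≤ 1 + 2 * d * 3 ^ (d - 1) * ((2 * R + 2 : ℕ) : ℝ) := by
  have hd0 : 0 < d := by omega
  have hinj : Set.InjOn (fun y : Site d => x - y) ↑(cube c (R + 1)) := fun a _ b _ h => sub_right_injective h
  rw [← Finset.sum_image (f := fun z : Site d => 1 / nrm z ^ (d - 1)) hinj]
  have hsub : (cube c (R + 1)).image (fun y => x - y) ⊆ cube (0 : Site d) (2 * R + 2) := by
    intro z hz
    rw [Finset.mem_image] at hz
    obtain ⟨y, hy, rfl⟩ := hz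
    rw [mem_cube] at hx hy ⊢
    intro i
    have h1 := hx i
    have h2 := hy i
    rw [Pi.zero_apply, sub_zero, Pi.sub_apply]
    calc |x i - y i| = |(x i - c i) - (y i - c i)| := by ring_nf
      _ ≤ |x i - c i| + |y i - c i| := abs_sub _ _
      _ ≤ ((R + 1 : ℕ) : ℤ) + ((R + 1 : ℕ) : ℤ) := add_le_add h1 h2
      _ = ((2 * R + 2 : ℕ) : ℤ) := by push_cast; ring
  calc ∑ z ∈ (cube c (R + 1)).image (fun y => x - y), 1 / nrm z ^ (d - 1)
      ≤ ∑ z ∈ cube (0 : Site d) (2 * R + 2), 1 / nrm z ^ (d - 1) :=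
        Finset.sum_le_sum_of_subset_of_nonneg hsub fun z _ _ => one_div_nonneg.mpr (pow_nonneg (nrm_pos z).le _)
    _ ≤ 1 + 2 * d * 3 ^ (d - 1) * ((2 * R + 2 : ℕ) : ℝ) ^ (d - (d - 1)) := sum_cube_inv_nrm_pow_le hd0 _ _ le_rfl
    _ = 1 + 2 * d * 3 ^ (d - 1) * ((2 * R + 2 : ℕ) : ℝ) := by rw [Nat.sub_sub_self (by omega : 1 ≤ d), pow_one]

/-! ## §3 The flat C¹ compact letter on a cube -/

/-- **THE FLAT C¹ COMPACT LETTER (dipole form), CUBE GEOMETRY** (`d ≥ 3`): `∃ C ≥ 0` (a function of `d`) such that for every cube `cube c R`, every bond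
field `Z` vanishing off it, every `B′ ≥ 0` bounding `‖curlAt 1 Z (z + e_λ) μ ν − curlAt 1 Z z μ ν‖` (`μ ≠ ν`) and every `D′` bounding
`‖flatDiv Z (x + e_λ) − flatDiv Z x‖`: `‖Z (x + e_μ) κ − Z x κ‖ ≤ C·(R + 1)·(B′ + D′)` — one lattice derivative on the data, one power of the radius. [folklore] -/
theorem gradient_letter_cube (hd : 3 ≤ d) : ∃ C : ℝ, 0 ≤ C ∧
    ∀ (c : Site d) (R : ℕ) (Z : Site d → Fin d → Matrix n n ℂ), (∀ x, x ∉ cube c R → Z x = 0) →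
      ∀ (B' : ℝ), 0 ≤ B' → (∀ (z : Site d) (lam μ ν : Fin d), μ ≠ ν →
        ‖curlAt (flat (d := d) (n := n)) Z (z + e lam) μ ν - curlAt (flat (d := d) (n := n)) Z z μ ν‖ ≤ B') →
      ∀ (D' : ℝ), (∀ (x : Site d) (lam : Fin d), ‖flatDiv Z (x + e lam) - flatDiv Z x‖ ≤ D') →
      ∀ (x : Site d) (μ κ : Fin d), ‖Z (x + e μ) κ - Z x κ‖ ≤ C * ((R : ℝ) + 1) * (B' + D') := by
  obtain ⟨C₁, hC₁, hG⟩ := G₀_diff_bound hd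
  have hd0 : 0 < d := by omega
  have hd1 : (1 : ℝ) ≤ d := by exact_mod_cast hd0
  have hA0 : (0 : ℝ) ≤ 2 * d * 3 ^ (d - 1) := by positivity
  refine ⟨2 * d * C₁ * (1 + 2 * d * 3 ^ (d - 1)), by positivity, fun c R Z hZ B' hB0 hB D' hD x μ κ => ?_⟩
  have hD0 : 0 ≤ D' := (norm_nonneg _).trans (hD x μ)
  have hR0 : (0 : ℝ) ≤ R := by positivity
  -- the componentwise Laplacian is bounded by `S = d B′ + D′`
  have hS0 : 0 ≤ (d : ℝ) * B' + D' := by positivity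
  have hlap : ∀ y, ‖∑ ν, ((Z (y + e ν) κ - Z y κ) - (Z y κ - Z (y - e ν) κ))‖ ≤ d * B' + D' :=
    fun y => norm_lapVec_le Z hB0 hB hD y κ
  have hrhs0 : 0 ≤ 2 * d * C₁ * (1 + 2 * d * 3 ^ (d - 1)) * ((R : ℝ) + 1) * (B' + D') := by positivity
  by_cases hx : x ∈ cube c (R + 1)
  swap
  · -- both ends of the bond lie outside the support
    have h1 : Z x = 0 := hZ x fun h => hx (cube_mono (Nat.le_succ R) h)
    have h2 : Z (x + e μ) = 0 := hZ (x + e μ) fun h => hx (mem_cube_succ_of_add_e h)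
    simp only [h1, h2, Pi.zero_apply, sub_self, norm_zero]
    exact hrhs0
  -- the dipole row sum seen from `x`
  have hrow := sum_cube_inv_nrm_sub_le hd c x R hx
  have hRow0 : (0 : ℝ) ≤ 1 + 2 * d * 3 ^ (d - 1) * ((2 * R + 2 : ℕ) : ℝ) := by positivity
  have hM0 : 0 ≤ C₁ * (d * B' + D') * (1 + 2 * d * 3 ^ (d - 1) * ((2 * R + 2 : ℕ) : ℝ)) := by positivity
  -- duality: every real functional of the increment is a dipole row sum against the scalar Laplacian
  have key : ‖Z (x + e μ) κ - Z x κ‖ ≤ C₁ * (d * B' + D') * (1 + 2 * d * 3 ^ (d - 1) * ((2 * R + 2 : ℕ) : ℝ)) := by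
    refine NormedSpace.norm_le_dual_bound ℝ _ hM0 fun f => ?_
    have hg : ∀ y, y ∉ cube c R → (fun z => f (Z z κ)) y = 0 := fun y hy => by
      simp only [hZ y hy, Pi.zero_apply, map_zero]
    have e1 : f (Z (x + e μ) κ) = -∑ y ∈ cube c (R + 1), G₀ (x + e μ - y) * latticeLaplacianZd (fun z => f (Z z κ)) y :=
      green_rep hd c R (fun z => f (Z z κ)) hg (x + e μ)
    have e2 : f (Z x κ) = -∑ y ∈ cube c (R + 1), G₀ (x - y) * latticeLaplacianZd (fun z => f (Z z κ)) y :=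
      green_rep hd c R (fun z => f (Z z κ)) hg x
    have hdiff : f (Z (x + e μ) κ - Z x κ) =
        -∑ y ∈ cube c (R + 1), (G₀ (x + e μ - y) - G₀ (x - y)) * latticeLaplacianZd (fun z => f (Z z κ)) y := by
      rw [map_sub, e1, e2]
      simp only [sub_mul, Finset.sum_sub_distrib]
      ring
    rw [hdiff, norm_neg]
    calc ‖∑ y ∈ cube c (R + 1), (G₀ (x + e μ - y) - G₀ (x - y)) * latticeLaplacianZd (fun z => f (Z z κ)) y‖
        ≤ ∑ y ∈ cube c (R + 1), ‖(G₀ (x + e μ - y) - G₀ (x - y)) * latticeLaplacianZd (fun z => f (Z z κ)) y‖ :=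
          norm_sum_le _ _
      _ ≤ ∑ y ∈ cube c (R + 1), (C₁ / nrm (x - y) ^ (d - 1)) * ((d * B' + D') * ‖f‖) :=
          Finset.sum_le_sum fun y _ => by
            rw [norm_mul]
            refine mul_le_mul ?_ ?_ (norm_nonneg _) (div_nonneg hC₁ (pow_nonneg (nrm_pos _).le _))
            · rw [Real.norm_eq_abs, show x + e μ - y = x - y + e μ by abel]
              exact (hG (x - y) μ).1
            · rw [lap_dual_apply]
              calc ‖f (∑ ν, ((Z (y + e ν) κ - Z y κ) - (Z y κ - Z (y - e ν) κ)))‖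
                  ≤ ‖f‖ * ‖∑ ν, ((Z (y + e ν) κ - Z y κ) - (Z y κ - Z (y - e ν) κ))‖ := f.le_opNorm _
                _ ≤ ‖f‖ * (d * B' + D') := mul_le_mul_of_nonneg_left (hlap y) (norm_nonneg _)
                _ = (d * B' + D') * ‖f‖ := mul_comm _ _
      _ = C₁ * (d * B' + D') * ‖f‖ * ∑ y ∈ cube c (R + 1), 1 / nrm (x - y) ^ (d - 1) := by
          rw [Finset.mul_sum]
          exact Finset.sum_congr rfl fun y _ => by ring
      _ ≤ C₁ * (d * B' + D') * ‖f‖ * (1 + 2 * d * 3 ^ (d - 1) * ((2 * R + 2 : ℕ) : ℝ)) :=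
          mul_le_mul_of_nonneg_left hrow (by positivity)
      _ = C₁ * (d * B' + D') * (1 + 2 * d * 3 ^ (d - 1) * ((2 * R + 2 : ℕ) : ℝ)) * ‖f‖ := by ring
  -- relax the constant: `d B′ + D′ ≤ d (B′ + D′)`, `1 + A(2R+2) ≤ (1 + A)·2(R+1)`
  have hS' : (d : ℝ) * B' + D' ≤ d * (B' + D') := by nlinarith
  have hRow' : 1 + 2 * d * 3 ^ (d - 1) * ((2 * R + 2 : ℕ) : ℝ) ≤ (1 + 2 * d * 3 ^ (d - 1)) * (2 * ((R : ℝ) + 1)) := by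
    push_cast
    nlinarith
  calc ‖Z (x + e μ) κ - Z x κ‖ ≤ C₁ * (d * B' + D') * (1 + 2 * d * 3 ^ (d - 1) * ((2 * R + 2 : ℕ) : ℝ)) := key
    _ ≤ C₁ * (d * (B' + D')) * ((1 + 2 * d * 3 ^ (d - 1)) * (2 * ((R : ℝ) + 1))) :=
        mul_le_mul (mul_le_mul_of_nonneg_left hS' hC₁) hRow' hRow0 (by positivity)
    _ = 2 * d * C₁ * (1 + 2 * d * 3 ^ (d - 1)) * ((R : ℝ) + 1) * (B' + D') := by ring

/-! ## §4 The same letter in the block-aligned-box geometry of `NE7FlatSupLetterCompact` -/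

/-- **THE FLAT C¹ COMPACT LETTER (dipole form), BOX GEOMETRY** (dimension `d + 1 ≥ 3`, every `L ≥ 1`, every `k`; `M = L^{k+1}`): `∃ K > 0` (a function of `d`)
such that for every block-aligned box `M•c′ + [0, M·N′)^{d+1}` (`N′ ≥ 1`), every bond field `Z` vanishing off the box (in particular every `Z` vanishing off its
`4M`-interior, the support clause of `NE7FlatSupLetterCompact.sup_flat_compact`), every `B′ ≥ 0` bounding `‖curlAt 1 Z (z + e_λ) μ ν − curlAt 1 Z z μ ν‖` (`μ ≠ ν`)
and every `D′` bounding `‖flatDiv Z (x + e_λ) − flatDiv Z x‖`: `‖Z (x + e_μ) κ − Z x κ‖ ≤ K·(L^{k+1}·N′)·(B′ + D′)` for all `x, μ, κ` — INTERFACE REQUEST NE7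
stub (S-c) (i) in the requested shape (no torus visible). [folklore] -/
theorem gradient_letter_box (hd : 2 ≤ d) :
    ∃ K : ℝ, 0 < K ∧ ∀ (L : ℕ), 1 ≤ L → ∀ (k : ℕ) (c' : Site (d + 1)) (N' : ℕ), 1 ≤ N' →
      ∀ (Z : Site (d + 1) → Fin (d + 1) → Matrix n n ℂ),
      (∀ x : Site (d + 1), (∃ i, ¬ (((L ^ (k + 1) : ℕ) : ℤ) * c' i ≤ x i ∧
          x i < ((L ^ (k + 1) : ℕ) : ℤ) * c' i + ((L ^ (k + 1) : ℕ) : ℤ) * N')) → Z x = 0) →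
      ∀ (B' : ℝ), 0 ≤ B' → (∀ (z : Site (d + 1)) (lam μ ν : Fin (d + 1)), μ ≠ ν →
        ‖curlAt (flat (d := d + 1) (n := n)) Z (z + e lam) μ ν - curlAt (flat (d := d + 1) (n := n)) Z z μ ν‖ ≤ B') →
      ∀ (D' : ℝ), (∀ (x : Site (d + 1)) (lam : Fin (d + 1)), ‖flatDiv Z (x + e lam) - flatDiv Z x‖ ≤ D') →
      ∀ (x : Site (d + 1)) (μ κ : Fin (d + 1)),
        ‖Z (x + e μ) κ - Z x κ‖ ≤ K * ((L : ℝ) ^ (k + 1) * N') * (B' + D') := by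
  obtain ⟨C, hC, h⟩ := gradient_letter_cube (d := d + 1) (n := n) (by omega)
  refine ⟨2 * C + 1, by positivity, fun L hL k c' N' hN' Z hZ B' hB0 hB D' hD x μ κ => ?_⟩
  have hD0 : 0 ≤ D' := (norm_nonneg _).trans (hD x μ)
  -- the box lies in the cube of radius `M N′` about its corner
  have hZ' : ∀ y, y ∉ cube (fun i => ((L ^ (k + 1) : ℕ) : ℤ) * c' i) (L ^ (k + 1) * N') → Z y = 0 := by
    intro y hy
    refine hZ y ?_
    by_contra hall
    simp only [not_exists, not_not] at hall
    apply hy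
    rw [mem_cube]
    intro i
    obtain ⟨h1, h2⟩ := hall i
    have hN0 : (0 : ℤ) ≤ ((L ^ (k + 1) : ℕ) : ℤ) * N' := by positivity
    rw [abs_le]
    constructor <;> push_cast at h1 h2 hN0 ⊢ <;> linarith
  have hM1 : 1 ≤ L ^ (k + 1) * N' := Nat.one_le_iff_ne_zero.mpr (Nat.mul_ne_zero (pow_ne_zero _ (by omega)) (by omega))
  have hR1 : (1 : ℝ) ≤ ((L ^ (k + 1) * N' : ℕ) : ℝ) := by exact_mod_cast hM1
  have hRr : ((L ^ (k + 1) * N' : ℕ) : ℝ) = (L : ℝ) ^ (k + 1) * N' := by push_cast; ring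
  have hBD : 0 ≤ B' + D' := by positivity
  calc ‖Z (x + e μ) κ - Z x κ‖ ≤ C * (((L ^ (k + 1) * N' : ℕ) : ℝ) + 1) * (B' + D') := h _ _ Z hZ' B' hB0 hB D' hD x μ κ
    _ ≤ (2 * C + 1) * ((L ^ (k + 1) * N' : ℕ) : ℝ) * (B' + D') := by
        apply mul_le_mul_of_nonneg_right _ hBD
        nlinarith
    _ = (2 * C + 1) * ((L : ℝ) ^ (k + 1) * N') * (B' + D') := by rw [hRr]

end

end Summit.QuantumFields.BalabanUV.T4Continuum.NE7FlatGradientLetterCompact
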